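import Summits.BirchSwinnertonDyer.BirchSwinnertonDyer.Theorems.PrintX11aMultThreeWinding
import Summits.BirchSwinnertonDyer.BirchSwinnertonDyer.Theorems.PrintX11aUpperNonSurjFiveMultTeichDefs
import HarnessLib

/-!
# OrbitP Sketch (crux idea `orbitp-minbranch`, ideator bsd-idea-17; reconstructed 2026-08-28 gen 0 re-arm for attestation, critic V#15 (P3))

Carriers of the card `Cruxes/UpperNonSurjFive/Ideas/orbitp-minbranch.md`:
* `MultMeasureUnitAt W p` — the FREE THEOREM target of the orbit-trick transplant 3 ↦ p: some plus symbol `[u/p^k]⁺`, `p ∤ u`,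
  `k ≥ 1`, is a `p`-adic unit (⟺ SOME even branch of the Mazur–Tate–Teitelbaum measure has μ = 0);
* `multMeasureUnitAt_three` — the p = 3 instance, PROVED from the width seat's landed p613999
  `MultThreeWinding.exists_one_le_norm_ratPlusSymbol_div_three_pow`;
* `FirstLemma` — the transplant target at every multiplicative `p ≥ 5` with `E[p]` irreducible (statement only);
* `EvenBranchSeparationAt W p := MultMeasureUnitAt W p → MultTeich.MultTeichOrbitUnitAt W p` — the typed RESIDUAL (= branch separation),
  with the modus-ponens reading `multTeichOrbitUnitAt_of`.
Nothing here advances U5; BSD is not proved; no stub of the skeleton of record is proved by this file.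
-/

set_option autoImplicit false

namespace Summit.BirchSwinnertonDyer.BirchSwinnertonDyer.Cruxes.UpperNonSurjFive.OrbitP

open scoped MatrixGroups ModularForm
open CongruenceSubgroup WeierstrassCurve
  Literature.NumberTheory.EllipticCurves Literature.NumberTheory.EllipticCurves.ModularForms
  Literature.NumberTheory.EllipticCurves.Rank1Residual

noncomputable section

/-- **Free-theorem carrier**: some mult-good plus symbol `[u/p^k]⁺_f` (`k ≥ 1`, `p ∤ u`) of every newform of `W` is a `p`-adic unit
(norm ≥ 1) — equivalently, SOME even branch of the MTT measure at the multiplicative prime `p` has μ-invariant 0. -/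
def MultMeasureUnitAt (W : WeierstrassCurve ℚ) (p : ℕ) [Fact p.Prime] : Prop :=
  ∀ {N : ℕ} [NeZero N] (f : CuspForm (Gamma0 N) 2), IsNewformOf W f →
    ∃ (k : ℕ) (u : ℤ), 1 ≤ k ∧ ¬ (p : ℤ) ∣ u ∧
      1 ≤ ‖((ratPlusSymbol f ((u : ℚ) / (p : ℚ) ^ k) : ℚ) : ℚ_[p])‖

/-- **The p = 3 instance is a THEOREM** (width seat x11a-p2, p613999 `PrintX11aMultThreeWinding`). -/
theorem multMeasureUnitAt_three (W : WeierstrassCurve ℚ) [W.IsElliptic] [W.IsGloballyMinimal]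
    (hmult : W.HasMultiplicativeReductionAtPrime 3) (hirr : W.HasIrreducibleModPGaloisRep 3) :
    @MultMeasureUnitAt W 3 ⟨Nat.prime_three⟩ := by
  intro N _ f hf
  obtain ⟨k, u, hk, hu, h⟩ :=
    Theorems.MultThreeWinding.exists_one_le_norm_ratPlusSymbol_div_three_pow W hmult hirr hf
  exact ⟨k, u, hk, by exact_mod_cast hu, by exact_mod_cast h⟩

/-- **Transplant target** (statement only; ≈ 1.8 kloc port of the p = 3 orbit trick with 3 ↦ p; a width-seat side theorem, advances U5 by 0 stubs). -/
def FirstLemma : Prop :=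
  ∀ (W : WeierstrassCurve ℚ) [W.IsElliptic] [W.IsGloballyMinimal] (p : ℕ) [Fact p.Prime], 5 ≤ p →
    W.HasMultiplicativeReductionAtPrime p → W.HasIrreducibleModPGaloisRep p → MultMeasureUnitAt W p

/-- **The residual = branch separation**: from «some even branch has μ = 0» to «the ω⁰ branch (Teichmüller orbit sum) has μ = 0». -/
def EvenBranchSeparationAt (W : WeierstrassCurve ℚ) (p : ℕ) [Fact p.Prime] : Prop :=
  MultMeasureUnitAt W p → MultTeich.MultTeichOrbitUnitAt W p

/-- Modus ponens, on purpose: the residual is exactly what separates the free theorem from the skeleton's orbit-unit carrier. -/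
theorem multTeichOrbitUnitAt_of (W : WeierstrassCurve ℚ) (p : ℕ) [Fact p.Prime]
    (h₁ : MultMeasureUnitAt W p) (h₂ : EvenBranchSeparationAt W p) : MultTeich.MultTeichOrbitUnitAt W p :=
  h₂ h₁

end

end Summit.BirchSwinnertonDyer.BirchSwinnertonDyer.Cruxes.UpperNonSurjFive.OrbitP
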